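import Literature.Combinatorics.Sahi2008.ProductOfChains
import HarnessLib

/-!
# `NoHeavyLowerTail` (stmt-CriticalPhenomena-4575), P2: Sahi positivity of EVERY order for families that factor through two
# independent chain statistics (pull-back of Lieb–Sahi's two-chain theorem along a block map)

Support file (seat `prim-masterthm-p2`, gen 15; `--supports stmt-CriticalPhenomena-4575`).  No `sorry`, no definitions, no named facts,
standard axioms.  Memo SAHI-ROUTE.md §4.39(h) (the "realisation principle" behind CHAIN-RUNG, here in its positive direction).

SETTING.  `X₁, X₂` finite types with probability weights `w₁, w₂` (e.g. two disjoint blocks of coins with their product weights),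
`ℓ₁ : X₁ → α`, `ℓ₂ : X₂ → β` ARBITRARY maps into finite nonempty linear orders ("chain statistics" of the two blocks: the number of
leading ones, the level `#{r : x ∈ A_r}` in a nested chain of up-sets `A₁ ⊇ A₂ ⊇ ⋯`, a threshold count, …), and a family
`f_i : α × β → ℝ` of nonnegative functions monotone on the product of the two chains.  Then (`sahiE_comp_prodMap_nonneg`)
  `E_n^{w₁ ⊗ w₂}(f_0 ∘ (ℓ₁ × ℓ₂), …, f_{n−1} ∘ (ℓ₁ × ℓ₂)) ≥ 0`  for EVERY `n`.
PROOF.  The push-forward of the product weight along `ℓ₁ × ℓ₂` is the product of the two push-forwards (`pushWeight_prodMap`), a product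
probability weight on `α × β`; `E_n` only sees push-forwards (`sahiE_pushWeight`); and every product probability weight on a product
of two finite chains is Sahi-positive of every order — Lieb–Sahi's Theorem 3.7 in the tree's discrete form
`ProductChains.sahiPositive_prodWeight_linearOrder` (`Literature/Combinatorics/Sahi2008/ProductOfChains.lean`).
READING for the crux (Kahn's Conjecture 5 = `C₃` on cubes, and Sahi's `C_n`): **every family of increasing events on a cube with a
product measure each of which is a monotone Boolean combination of the levels of ONE nested chain of up-sets on a block `B` and ONE
nested chain of up-sets on the complementary block `Bᶜ` ("bichain families") satisfies `E_n ≥ 0` for all `n`** — a solved class for the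
core engine `SahiClassTCube.sahiE_three_nonneg_of_core_step`, transversal to class T / canalyzing / junta criteria (its members can be
essential on every coordinate and triply intersecting).  Monotonicity of `ℓ₁, ℓ₂` is not even needed for the sign (only to make the pulled-back
events increasing).  HONEST FRAMING: a pull-back of a theorem in print; `C₃` in general remains OPEN.
[cite: LiebSahi2021, Thm. 3.7 and Lemma 2.3]; [cite: Kahn2022, p. 2 (underlying independents)].
-/

noncomputable section

open scoped Classical

namespace Summit.CriticalPhenomena.PercolationContinuityZ3.Theorems

namespace SahiBiChainPullback

open Finset Literature.Combinatorics.Sahi2008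

variable {X₁ X₂ α β : Type*} [Fintype X₁] [Fintype X₂]

/-- **The push-forward of a product weight along a product map is the product of the push-forwards.** [folklore] -/
theorem pushWeight_prodMap (w₁ : X₁ → ℝ) (w₂ : X₂ → ℝ) (ℓ₁ : X₁ → α) (ℓ₂ : X₂ → β) (c : α × β) :
    pushWeight (fun p : X₁ × X₂ => w₁ p.1 * w₂ p.2) (Prod.map ℓ₁ ℓ₂) c =
      pushWeight w₁ ℓ₁ c.1 * pushWeight w₂ ℓ₂ c.2 := by
  obtain ⟨c₁, c₂⟩ := c
  simp only [pushWeight]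
  rw [Fintype.sum_prod_type, Finset.sum_mul_sum]
  refine Finset.sum_congr rfl fun x _ => Finset.sum_congr rfl fun y _ => ?_
  by_cases h1 : ℓ₁ x = c₁ <;> by_cases h2 : ℓ₂ y = c₂ <;> simp [Prod.map, h1, h2]

/-- **Sahi positivity of every order for families factoring through two independent chain statistics.**  `w₁, w₂` probability
weights on finite types `X₁, X₂`; `ℓ₁, ℓ₂` any maps into finite nonempty linear orders; `f_i ≥ 0` monotone on `α × β`.  Then
`E_n^{w₁⊗w₂}(f ∘ (ℓ₁ × ℓ₂)) ≥ 0`. [cite: LiebSahi2021, Thm. 3.7] -/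
theorem sahiE_comp_prodMap_nonneg [Fintype α] [Fintype β] [LinearOrder α] [LinearOrder β] [Nonempty α] [Nonempty β]
    (w₁ : X₁ → ℝ) (w₂ : X₂ → ℝ) (h₁0 : ∀ x, 0 ≤ w₁ x) (h₁1 : ∑ x, w₁ x = 1) (h₂0 : ∀ y, 0 ≤ w₂ y)
    (h₂1 : ∑ y, w₂ y = 1) (ℓ₁ : X₁ → α) (ℓ₂ : X₂ → β) (n : ℕ) (f : Fin n → α × β → ℝ) (hf : ∀ i c, 0 ≤ f i c)
    (hmono : ∀ i, Monotone (f i)) :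
    0 ≤ sahiE (fun p : X₁ × X₂ => w₁ p.1 * w₂ p.2) n (fun i => f i ∘ Prod.map ℓ₁ ℓ₂) := by
  rw [← sahiE_pushWeight]
  have hpush : pushWeight (fun p : X₁ × X₂ => w₁ p.1 * w₂ p.2) (Prod.map ℓ₁ ℓ₂) =
      fun c : α × β => pushWeight w₁ ℓ₁ c.1 * pushWeight w₂ ℓ₂ c.2 :=
    funext fun c => pushWeight_prodMap w₁ w₂ ℓ₁ ℓ₂ c
  rw [hpush]
  refine ProductChains.sahiPositive_prodWeight_linearOrder (pushWeight w₁ ℓ₁) (pushWeight w₂ ℓ₂)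
    (fun a => pushWeight_nonneg h₁0 ℓ₁ a) ?_ (fun b => pushWeight_nonneg h₂0 ℓ₂ b) ?_ n f hf hmono
  · rw [sum_pushWeight, h₁1]
  · rw [sum_pushWeight, h₂1]

/-- **Coin form.**  Two disjoint blocks of independent coins `ι₁, ι₂` with biases `q₁, q₂ ∈ [0,1]`, chain statistics `ℓ₁, ℓ₂` of the two
blocks, `f_i ≥ 0` monotone on the product of the two chains: `E_n ≥ 0` under the product coin weight for the pulled-back family
("bichain families" of the module docstring; with `ℓ₁, ℓ₂` monotone these are families of increasing functions of the coins).
[cite: LiebSahi2021, Thm. 3.7; Kahn2022, p. 2] -/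
theorem sahiE_coin_biChain_nonneg {ι₁ ι₂ : Type*} [Fintype ι₁] [Fintype ι₂] [Fintype α] [Fintype β] [LinearOrder α]
    [LinearOrder β] [Nonempty α]
    [Nonempty β] (q₁ : ι₁ → ℝ) (q₂ : ι₂ → ℝ) (hq₁ : ∀ i, 0 ≤ q₁ i ∧ q₁ i ≤ 1) (hq₂ : ∀ i, 0 ≤ q₂ i ∧ q₂ i ≤ 1)
    (ℓ₁ : (ι₁ → Bool) → α) (ℓ₂ : (ι₂ → Bool) → β) (n : ℕ) (f : Fin n → α × β → ℝ) (hf : ∀ i c, 0 ≤ f i c)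
    (hmono : ∀ i, Monotone (f i)) :
    0 ≤ sahiE (fun p : (ι₁ → Bool) × (ι₂ → Bool) => coinWeight q₁ p.1 * coinWeight q₂ p.2) n
      (fun i => f i ∘ Prod.map ℓ₁ ℓ₂) :=
  sahiE_comp_prodMap_nonneg (coinWeight q₁) (coinWeight q₂) (fun y => coinWeight_nonneg hq₁ y) (sum_coinWeight q₁)
    (fun y => coinWeight_nonneg hq₂ y) (sum_coinWeight q₂) ℓ₁ ℓ₂ n f hf hmono

/-- The pulled-back family is monotone when the chain statistics are (so the coin form is a statement about INCREASING functions
of the coins). [folklore] -/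
theorem monotone_comp_prodMap {ι₁ ι₂ : Type*} [Preorder α] [Preorder β] {ℓ₁ : (ι₁ → Bool) → α} {ℓ₂ : (ι₂ → Bool) → β}
    (hℓ₁ : Monotone ℓ₁) (hℓ₂ : Monotone ℓ₂) {g : α × β → ℝ} (hg : Monotone g) : Monotone (g ∘ Prod.map ℓ₁ ℓ₂) :=
  hg.comp (hℓ₁.prodMap hℓ₂)

end SahiBiChainPullback

end Summit.CriticalPhenomena.PercolationContinuityZ3.Theorems
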